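import Mathlib
import Literature.MathematicalPhysics.QuantumFieldTheory.Balaban1983to89.B6RandomWalk
import Literature.MathematicalPhysics.QuantumFieldTheory.Balaban1983to89.B11

/-!
# `Balaban1983to89.B11SectG` — [Balaban1985Variational] Sect. G, pp. 307–309: the decay of (δ/δB)𝓗(B),
(182)–(190).  (189) NAMED as the located, author-omitted input; the printed inference
*"This inequality, the formula (188) and Lemma 2.1 … yield (190)"* KERNEL-CHECKED over block majorants,
with the rate ¼δ₀ ↦ ⅛δ₀ DERIVED and the constant and the smallness of (187) EXPLICIT.

CITATION HEADER (lean-in-tree rule 2026-08-18).  Source: T. Bałaban, *The variational problem and background fields in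
renormalization group method for lattice gauge theories*, Commun. Math. Phys. **102**, 277–309 (1985),
doi:10.1007/bf01229381 (cell paper B11; held `paper:balaban1985-cmp102-variational-background`; journal page = PDF page
+ 276; every quotation below is read from the page renders pp. 289, 307, 308, 309 [PDF 13, 31, 32, 33],
`b2b-balaban-ref1/pages/1985-cmp102-variational-background/…-p013,p031,p032,p033-x2.png`).  Lemma 2.1 = Lemma 2.1 of
[Balaban1984PropagatorsII] (= ref. [3] of the paper; sibling modules `…B6`, `…B6RandomWalk`).  The sibling module
`…Balaban1983to89.B11` (gen 1: Props 2–9, Thm 1, `B11.Prop9Printed` with the five entries of (190) as `B11.pref190`) is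
NOT modified; this module is the Sect. G OPERATOR LAYER underneath `B11.Prop9Printed`'s last clause.

WHAT IS REPRODUCED.
(a) The printed operator identities (182), (183)/(184), (188) and the bounds (186), (187), (189), (190) as NAMED
hypotheses / conclusions of the printed SHAPE over an abstract block-majorant vocabulary (`BlockNorm`, `HasMaj`): an
operator T between two spaces of lattice functions has MAJORANT K(y, y′) on 𝔅 × 𝔅 when *"the size of Tμ near y is
≤ K(y, y′) × the size of μ, for μ localised near y′"* — exactly the shape of (73) p. 289 (*"|𝔇(A′; c, b)| ≤
O(1)C₃ε₃(L^jη)^{−d+1}e^{−½δ₀d(c₋,y)}, b ∈ B^j(y), y ∈ Λ_j"*), of (189) (*"for supp 𝔄 ⊂ Δ̃(y′), … y ∈ Λ_j"*) and of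
(190) (*"for x ∈ Δ(y), or supp ζ ⊂ Δ̃(y), y ∈ Λ_j, y′ ∈ Λ_{j′}"*).  The generalisation over `B6RandomWalk.HasMajorant`
(which is the special case "size = sup over the sharp block B^j(y)", `hasMaj_of_hasMajorant`) is forced by (189):
its input size is the WEIGHTED C¹-norm max{|𝔄|_{(−1)}, |∇𝔄|_{(−2)}} of p. 308, which sharp block cut-offs do not
respect, so the block decomposition *"Σ_y Δ(y) = I"* of [3] (2.52) is typed as an abstract partition of unity `cut`
with a cost constant `κ` (`BlockNorm.loc_cut_le`) — for sharp blocks κ = 1.  The scale weights (L^jη)^{−1}, (L^jη)^{−2},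
(L^jη)^{−3} of (186)–(190) live INSIDE the local sizes (|·|_{(−n)} = sup (L^jη)^n|·| as on pp. 284, 308), and the factor
(L^{j′}η)^{−d} of (190) is the normalisation of the kernel w.r.t. the η-scale pairing on 𝔅_k (the response to a unit
B at one point y′ ∈ Λ_{j′}); so a majorant "C·e^{−⅛δ₀d(y,y′)}" from (B on 𝔅_k, sup) to (𝔄, |·|_{(−1)} ⊔ |∇·|_{(−2)})
IS the pair of entries n = 0, 1 of (190)/`B11.pref190`, and into the second-order local size it is entries n = 3, 4.
(b) KERNEL-CHECKED: `hasMaj_comp` (majorants compose by 𝔅-convolution, cost κ), `hasMaj_comp_exp` (rate bookkeeping: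
e^{−ρ₁d} ∗ e^{−ρ₂d} ≤ c·e^{−ρd} whenever ρ ≤ ρ₂ and ρ + σ ≤ ρ₁, from the triangle inequality (2.54) of [3] and the row
sum (2.61) of Lemma 2.1 [3] at rate σ), `neumann_majorant` (= the content of *"(188) and Lemma 2.1"*: if 𝔄₀ = S + K′𝔄₀
with K′ of majorant θe^{−δd}, S of majorant A e^{−ρd}, ρ + σ ≤ δ, and 𝔄₀ A PRIORI BOUNDED — the norm-convergent
Neumann series (188) under (187) — then 𝔄₀ has majorant A(1 − q)⁻¹e^{−ρd}, q = κθc(σ), PROVIDED q < 1),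
`ineq190_of_189` (the assembly (184) + (189) + (182) ⇒ entries 1–2 of (190) at the rate ⅛δ₀ with every constant
explicit) and `ineq190_strong_of_189` (entries 3–5 of (190) from entries 1–2 plus the LOCATED second-order inputs).
CENSUS RESULT of (b): (i) the printed halving of the rate, (189) e^{−¼δ₀d} ↦ (190) e^{−⅛δ₀d}, is exactly the (1 − α),
α = ½, loss of Lemma 2.1's summation ([3] (2.63)/(2.65): δ₀ ↦ ½δ₀), used at the rate ¼δ₀ — i.e. Lemma 2.1 is invoked
with the summable factor e^{−⅛δ₀d(y,y″)}, hence under [3] (2.59) with αδ₀ ↦ ⅛δ₀ (cell SMALLNESS); (ii) the Neumann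
series needs q = κ·(operator constant of G̃·(δ²V/δA′²))·c₁ < 1 — the *"for ε₁ sufficiently small, hence the norm of
the linear operator is small also"* of (187), LOCATED with its constant; (iii) entries 3–5 of (190) need NO second
Neumann series: one more application of (184) with the second-order majorants of G̃ (p. 306 *"the new operator G has
exactly the same properties as Δ_a⁻¹"*, cell GAPS G-B11-G1), of H₀ ((130) p. 297, printed) and of H ((137)–(139)
p. 298, G-B11-E4R) — these three are the located inputs.
WHAT IS *NOT* REPRODUCED OR ASSERTED: (189) itself — p. 308, verbatim: *"To prove an exponential decay we have to
investigate more closely the kernel ((δ²/δA′²)V)(A′). This is, unfortunately, a very awkward and complicated problem,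
although quite straightforward. … Now we have to differentiate those expressions second time. We do not perform these
calculations here, we have obtained all necessary results to do the calculations and estimates, let us formulate a
final result only"* (cell GAPS G-B11-G2, KEY, load-bearing for [Balaban1987RG1] (3.9), (3.17), (3.32), (4.5)); the
majorants of G̃, H₀, H, 𝔇, Δ^{(2)}H₀ (hypotheses of the printed shapes (112)–(113), (129)–(130), (46)+(162), (73),
(130)+(38)–(40)); the words *"and finally Proposition 2 and (181)"* (the transport of the bound from the base point to a
general B in the analyticity domain (170) — not typed; cell GAPS G-B11-G2a); the Hölder entry n = 2 of (190) beyond the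
remark that it is `ineq190_strong_of_189` for a local size containing the Hölder quotient.  NOTHING of the series is
asserted; value = typed skeleton + located gaps + kernel-checked bookkeeping, NOT summit progress.  Unit
`b2b-balaban-b11-g2` (paper sub-cell B11, gen 2); companion rows: cell `GAPS.md` G-B11-G2, G-B11-G2a, C-B11-G4,
`DIVERGENCE.md` D-B11-9, `SMALLNESS.md` S-B11.G, `b2b-balaban-b11/B11.md` §G2, `b2b-balaban-b11/CONSUMERS-g2.md`.
-/

namespace Literature.MathematicalPhysics.QuantumFieldTheory.Balaban1983to89.B11SectG

open Literature.MathematicalPhysics.QuantumFieldTheory.Balaban1983to89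
open Finset B6RandomWalk

/-! ## Block sizes and majorants (the shape of (73), (189), (190)) -/

/-- A BLOCK-NORMED space of lattice functions over the multiscale set 𝔅 = `g.Site` of [3] (2.45): `loc y f` = the
size of f near y ∈ 𝔅 (e.g. sup_{x∈Δ(y)}|f(x)|, or the weighted sizes (L^jη)·sup_{Δ̃(y)}|𝔄| ⊔ (L^jη)²·sup_{Δ̃(y)}|∇𝔄|
of p. 308, or (L^jη)³·sup_{Δ(y)}|·| of (186)/(189)); `cut y` = the y-piece of a partition of unity (*"Σ_y Δ(y) = I"*,
[3] (2.52); for the C¹-type sizes a smooth partition subordinate to the enlarged blocks Δ̃(y)); `IsLoc y μ` = *"μ is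
localised near y"* (*"supp λ ⊂ B^{j′}(y′)"* [3] p. 232, *"supp 𝔄 ⊂ Δ̃(y′)"* (189)); `κ` = the cost of cutting:
loc y (cut y f) ≤ κ·loc y f (κ = 1 for sharp blocks and sup sizes).
[cite: Balaban1985Variational, (189)–(190) p.308; Balaban1984PropagatorsII, (2.51)–(2.52) p.232] -/
structure BlockNorm (g : B6.Geometry) (F : Type) [AddCommGroup F] [Module ℝ F] where
  loc : g.Site → F → ℝ
  cut : g.Site → F →ₗ[ℝ] F
  IsLoc : g.Site → F → Prop
  κ : ℝ
  κ_nonneg : 0 ≤ κ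
  loc_nonneg : ∀ y f, 0 ≤ loc y f
  loc_zero : ∀ y, loc y 0 = 0
  loc_add_le : ∀ y f f', loc y (f + f') ≤ loc y f + loc y f'
  loc_neg : ∀ y f, loc y (-f) = loc y f
  sum_cut : ∀ f, ∑ y, cut y f = f
  isLoc_cut : ∀ y f, IsLoc y (cut y f)
  loc_cut_le : ∀ y f, loc y (cut y f) ≤ κ * loc y f

variable {g : B6.Geometry}
variable {F₁ F₂ F₃ : Type} [AddCommGroup F₁] [Module ℝ F₁] [AddCommGroup F₂] [Module ℝ F₂]
  [AddCommGroup F₃] [Module ℝ F₃]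

/-- Finite sums: loc y (Σᵢ fᵢ) ≤ Σᵢ loc y fᵢ. [folklore] -/
theorem BlockNorm.loc_sum_le (b : BlockNorm g F₁) (y : g.Site) {ι : Type} (s : Finset ι) (f : ι → F₁) :
    b.loc y (∑ i ∈ s, f i) ≤ ∑ i ∈ s, b.loc y (f i) := by
  classical
  induction s using Finset.induction_on with
  | empty => simp [b.loc_zero]
  | insert i s hi ih =>
      rw [Finset.sum_insert hi, Finset.sum_insert hi]
      exact (b.loc_add_le y _ _).trans (by linarith)

/-- loc y (f − f′) ≤ loc y f + loc y f′. [folklore] -/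
theorem BlockNorm.loc_sub_le (b : BlockNorm g F₁) (y : g.Site) (f f' : F₁) :
    b.loc y (f - f') ≤ b.loc y f + b.loc y f' := by
  rw [sub_eq_add_neg]
  exact (b.loc_add_le y f (-f')).trans (by rw [b.loc_neg])

/-- The printed shape of (73), (189), (190) (and of [3] (2.51), (2.64)–(2.66)): the linear operator T from the
block-normed space `b₁` to the block-normed space `b₂` has the MAJORANT K on 𝔅 × 𝔅 — *"(size of Tμ near y) ≤ K(y, y′)
· (size of μ), μ localised near y′"*. [cite: Balaban1985Variational, (73) p.289 + (189)–(190) p.308] -/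
def HasMaj (b₁ : BlockNorm g F₁) (b₂ : BlockNorm g F₂) (T : F₁ →ₗ[ℝ] F₂) (K : g.Site → g.Site → ℝ) : Prop :=
  ∀ (y' : g.Site) (μ : F₁), b₁.IsLoc y' μ → ∀ y : g.Site, b₂.loc y (T μ) ≤ K y y' * b₁.loc y' μ

/-- The vocabulary is CONSERVATIVE over `B6RandomWalk.HasMajorant`: for functions on a lattice `X` with the sharp
blocks of `blk : X → 𝔅`, the sup-over-the-block size, the sharp restriction `blockPiece` as `cut` (κ = 1) and
"vanishes off the block of y′" as `IsLoc`, every `HasMajorant blk T K` with K ≥ 0 is a `HasMaj`. [folklore] -/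
noncomputable def BlockNorm.ofBlocks (g : B6.Geometry) {X : Type} [Fintype X] (blk : X → g.Site) :
    BlockNorm g (X → ℝ) := by
  classical
  refine
    { loc := fun y f => ⨆ x : X, if blk x = y then |f x| else 0
      cut := fun y =>
        { toFun := blockPiece blk y
          map_add' := fun f f' => by
            funext x; by_cases hx : blk x = y <;> simp [blockPiece, hx]
          map_smul' := fun c f => by
            funext x; by_cases hx : blk x = y <;> simp [blockPiece, hx] }
      IsLoc := fun y μ => ∀ x, blk x ≠ y → μ x = 0
      κ := 1
      κ_nonneg := zero_le_one
      loc_nonneg := ?_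
      loc_zero := ?_
      loc_add_le := ?_
      loc_neg := ?_
      sum_cut := fun f => sum_blockPiece blk f
      isLoc_cut := ?_
      loc_cut_le := ?_ }
  · intro y f
    by_cases hX : Nonempty X
    · exact le_ciSup_of_le (Finite.bddAbove_range _) (Classical.arbitrary X)
        (by split_ifs <;> simp [abs_nonneg])
    · rw [not_nonempty_iff] at hX
      simp [iSup_of_empty']
  · intro y
    by_cases hX : Nonempty X
    · simp
    · rw [not_nonempty_iff] at hX
      simp [iSup_of_empty']
  · intro y f f'
    by_cases hX : Nonempty X
    · refine ciSup_le fun x => ?_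
      have h1 := le_ciSup (Finite.bddAbove_range fun x : X => if blk x = y then |f x| else 0) x
      have h2 := le_ciSup (Finite.bddAbove_range fun x : X => if blk x = y then |f' x| else 0) x
      by_cases hx : blk x = y
      · simp only [hx, if_true, Pi.add_apply] at h1 h2 ⊢
        exact (abs_add_le (f x) (f' x)).trans (add_le_add h1 h2)
      · simp only [hx, if_false] at h1 h2 ⊢
        exact add_nonneg h1 h2
    · rw [not_nonempty_iff] at hX
      simp [iSup_of_empty']
  · intro y f
    simp [abs_neg]
  · intro y f x hx
    simp [blockPiece, hx]
  · intro y f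
    rw [one_mul]
    by_cases hX : Nonempty X
    · refine ciSup_le fun x => ?_
      refine le_trans ?_ (le_ciSup (Finite.bddAbove_range _) x)
      by_cases hx : blk x = y <;> simp [blockPiece, hx]
    · rw [not_nonempty_iff] at hX
      simp [iSup_of_empty']

/-- Conservativity: a `B6RandomWalk.HasMajorant` with non-negative kernel is a `HasMaj` between the sharp-block sup
sizes. [folklore] -/
theorem hasMaj_of_hasMajorant {X : Type} [Fintype X] (blk : X → g.Site) {T : Module.End ℝ (X → ℝ)}
    {K : g.Site → g.Site → ℝ} (hK : ∀ a b, 0 ≤ K a b) (h : HasMajorant blk T K) :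
    HasMaj (BlockNorm.ofBlocks g blk) (BlockNorm.ofBlocks g blk) T K := by
  classical
  intro y' μ hμ y
  -- the sup of |μ| over the block of y′ is a `BlockSupp` bound
  set B : ℝ := (BlockNorm.ofBlocks g blk).loc y' μ with hB
  have hBdef : B = ⨆ x : X, if blk x = y' then |μ x| else 0 := rfl
  have hB0 : 0 ≤ B := (BlockNorm.ofBlocks g blk).loc_nonneg y' μ
  have hsupp : BlockSupp blk μ y' B := by
    refine ⟨hB0, fun x hx => ?_, fun x hx => hμ x hx⟩
    rw [hBdef]
    refine le_trans ?_ (le_ciSup (Finite.bddAbove_range _) x)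
    simp [hx]
  have hpt : ∀ x : X, |T μ x| ≤ K (blk x) y' * B := h y' μ B hsupp
  show (⨆ x : X, if blk x = y then |T μ x| else 0) ≤ K y y' * B
  by_cases hX : Nonempty X
  · refine ciSup_le fun x => ?_
    split_ifs with hx
    · simpa [hx] using hpt x
    · exact mul_nonneg (hK _ _) hB0
  · rw [not_nonempty_iff] at hX
    simp only [iSup_of_empty', Real.sSup_empty]
    exact mul_nonneg (hK _ _) hB0

/-! ## Algebra of majorants -/

/-- Majorants pass along pointwise-equal operators. [folklore] -/
theorem HasMaj.congr {b₁ : BlockNorm g F₁} {b₂ : BlockNorm g F₂} {T T' : F₁ →ₗ[ℝ] F₂} {K : g.Site → g.Site → ℝ}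
    (h : HasMaj b₁ b₂ T K) (hTT' : ∀ μ, T μ = T' μ) : HasMaj b₁ b₂ T' K :=
  fun y' μ hμ y => by rw [← hTT' μ]; exact h y' μ hμ y

/-- Monotonicity in the kernel. [folklore] -/
theorem HasMaj.mono {b₁ : BlockNorm g F₁} {b₂ : BlockNorm g F₂} {T : F₁ →ₗ[ℝ] F₂} {K K' : g.Site → g.Site → ℝ}
    (h : HasMaj b₁ b₂ T K) (hle : ∀ a b, K a b ≤ K' a b) : HasMaj b₁ b₂ T K' :=
  fun y' μ hμ y => (h y' μ hμ y).trans (mul_le_mul_of_nonneg_right (hle _ _) (b₁.loc_nonneg _ _))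

/-- USE / NON-VACUITY of a majorant: with K ≥ 0 it bounds T on EVERY input, through the partition of unity of the
source space — loc_y(Tf) ≤ Σ_{y′} K(y,y′)·κ₁·loc_{y′}(f) (the passage from (2.51) to an operator-norm bound, [3]
(2.52)–(2.53)). [cite: Balaban1984PropagatorsII, (2.52)–(2.53) p.232] -/
theorem HasMaj.bound {b₁ : BlockNorm g F₁} {b₂ : BlockNorm g F₂} {T : F₁ →ₗ[ℝ] F₂} {K : g.Site → g.Site → ℝ}
    (h : HasMaj b₁ b₂ T K) (hK : ∀ a b, 0 ≤ K a b) (f : F₁) (y : g.Site) :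
    b₂.loc y (T f) ≤ ∑ y' : g.Site, K y y' * (b₁.κ * b₁.loc y' f) := by
  have hdec : T f = ∑ y' : g.Site, T (b₁.cut y' f) := by
    conv_lhs => rw [← b₁.sum_cut f]
    rw [map_sum]
  rw [hdec]
  refine (b₂.loc_sum_le y _ _).trans (Finset.sum_le_sum fun y' _ => ?_)
  calc b₂.loc y (T (b₁.cut y' f)) ≤ K y y' * b₁.loc y' (b₁.cut y' f) := h y' _ (b₁.isLoc_cut y' f) y
    _ ≤ K y y' * (b₁.κ * b₁.loc y' f) := mul_le_mul_of_nonneg_left (b₁.loc_cut_le y' f) (hK _ _)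

/-- The zero operator. [folklore] -/
theorem hasMaj_zero (b₁ : BlockNorm g F₁) (b₂ : BlockNorm g F₂) :
    HasMaj b₁ b₂ (0 : F₁ →ₗ[ℝ] F₂) (fun _ _ => 0) := by
  intro y' μ _ y
  simp [b₂.loc_zero]

/-- *"A summation preserves it also"* ([3] p. 232): majorants add. [cite: Balaban1984PropagatorsII, p.232] -/
theorem HasMaj.add {b₁ : BlockNorm g F₁} {b₂ : BlockNorm g F₂} {T₁ T₂ : F₁ →ₗ[ℝ] F₂}
    {K₁ K₂ : g.Site → g.Site → ℝ} (h₁ : HasMaj b₁ b₂ T₁ K₁) (h₂ : HasMaj b₁ b₂ T₂ K₂) :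
    HasMaj b₁ b₂ (T₁ + T₂) (fun a b => K₁ a b + K₂ a b) := by
  intro y' μ hμ y
  rw [LinearMap.add_apply, add_mul]
  exact (b₂.loc_add_le y _ _).trans (add_le_add (h₁ y' μ hμ y) (h₂ y' μ hμ y))

/-- Majorants are insensitive to the sign of the operator. [folklore] -/
theorem HasMaj.neg {b₁ : BlockNorm g F₁} {b₂ : BlockNorm g F₂} {T : F₁ →ₗ[ℝ] F₂} {K : g.Site → g.Site → ℝ}
    (h : HasMaj b₁ b₂ T K) : HasMaj b₁ b₂ (-T) K := by
  intro y' μ hμ y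
  rw [LinearMap.neg_apply, b₂.loc_neg]
  exact h y' μ hμ y

/-- Differences. [folklore] -/
theorem HasMaj.sub {b₁ : BlockNorm g F₁} {b₂ : BlockNorm g F₂} {T₁ T₂ : F₁ →ₗ[ℝ] F₂}
    {K₁ K₂ : g.Site → g.Site → ℝ} (h₁ : HasMaj b₁ b₂ T₁ K₁) (h₂ : HasMaj b₁ b₂ T₂ K₂) :
    HasMaj b₁ b₂ (T₁ - T₂) (fun a b => K₁ a b + K₂ a b) := by
  rw [sub_eq_add_neg]
  exact h₁.add h₂.neg

/-- Finite sums of operators. [folklore] -/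
theorem hasMaj_sum {b₁ : BlockNorm g F₁} {b₂ : BlockNorm g F₂} (T : ℕ → F₁ →ₗ[ℝ] F₂)
    (K : ℕ → g.Site → g.Site → ℝ) (h : ∀ n, HasMaj b₁ b₂ (T n) (K n)) (N : ℕ) :
    HasMaj b₁ b₂ (∑ n ∈ Finset.range N, T n) (fun a b => ∑ n ∈ Finset.range N, K n a b) := by
  induction N with
  | zero => simpa using hasMaj_zero b₁ b₂
  | succ N ih =>
      have := ih.add (h N)
      simpa [Finset.sum_range_succ] using this

/-- **Composition** ([3] (2.52) ⇒ (2.55): *"this property is preserved under the composition of operators possessing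
it"*; here with the cutting cost κ of the intermediate space): if T₂ : F₁ → F₂ has majorant K₂ and T₁ : F₂ → F₃ has
majorant K₁ ≥ 0, then T₁T₂ has the 𝔅-convolution Σ_{y″} K₁(y,y″)·κ₂·K₂(y″,y′) as majorant — insert the partition of
unity Σ_{y″} cut y″ = I of the intermediate space between the factors. [cite: Balaban1984PropagatorsII, (2.52)–(2.55) p.232] -/
theorem hasMaj_comp {b₁ : BlockNorm g F₁} {b₂ : BlockNorm g F₂} {b₃ : BlockNorm g F₃}
    {T₁ : F₂ →ₗ[ℝ] F₃} {T₂ : F₁ →ₗ[ℝ] F₂} {K₁ K₂ : g.Site → g.Site → ℝ}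
    (h₁ : HasMaj b₂ b₃ T₁ K₁) (h₂ : HasMaj b₁ b₂ T₂ K₂) (hK₁ : ∀ a b, 0 ≤ K₁ a b) :
    HasMaj b₁ b₃ (T₁ ∘ₗ T₂) (fun a b => ∑ y'' : g.Site, K₁ a y'' * (b₂.κ * K₂ y'' b)) := by
  intro y' μ hμ y
  have hν : ∀ y'', b₂.loc y'' (T₂ μ) ≤ K₂ y'' y' * b₁.loc y' μ := h₂ y' μ hμ
  have hdec : T₁ (T₂ μ) = ∑ y'' : g.Site, T₁ (b₂.cut y'' (T₂ μ)) := by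
    conv_lhs => rw [← b₂.sum_cut (T₂ μ)]
    rw [map_sum]
  rw [LinearMap.comp_apply, hdec, Finset.sum_mul]
  refine (b₃.loc_sum_le y _ _).trans (Finset.sum_le_sum fun y'' _ => ?_)
  calc b₃.loc y (T₁ (b₂.cut y'' (T₂ μ)))
      ≤ K₁ y y'' * b₂.loc y'' (b₂.cut y'' (T₂ μ)) := h₁ y'' _ (b₂.isLoc_cut y'' _) y
    _ ≤ K₁ y y'' * (b₂.κ * b₂.loc y'' (T₂ μ)) :=
        mul_le_mul_of_nonneg_left (b₂.loc_cut_le y'' _) (hK₁ _ _)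
    _ ≤ K₁ y y'' * (b₂.κ * (K₂ y'' y' * b₁.loc y' μ)) :=
        mul_le_mul_of_nonneg_left (mul_le_mul_of_nonneg_left (hν y'') b₂.κ_nonneg) (hK₁ _ _)
    _ = K₁ y y'' * (b₂.κ * K₂ y'' y') * b₁.loc y' μ := by ring

/-! ## Rate bookkeeping: the row sum (2.61) of Lemma 2.1 [3] and the triangle inequality (2.54) -/

/-- *"sup_{y∈𝔅} Σ_{y′∈𝔅} e^{−σd(y,y′)} ≤ c"* — the row-sum bound (2.61) of Lemma 2.1 [3] at the rate σ with the
constant c; `B6RandomWalk.Ineq261 d g δ₀ α` is literally `RowSum g (α * δ₀) (B6.c1 d δ₀ α)` (`rowSum_iff_ineq261`).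
[cite: Balaban1984PropagatorsII, Lemma 2.1 (2.61) p.234] -/
def RowSum (g : B6.Geometry) (σ c : ℝ) : Prop :=
  ∀ y : g.Site, ∑ y' : g.Site, Real.exp (-(σ * g.dist y y')) ≤ c

/-- (2.61) at rate αδ₀ IS the row sum at σ = αδ₀ with c = c₁(α). [cite: Balaban1984PropagatorsII, (2.61) p.234] -/
theorem rowSum_iff_ineq261 (d : ℕ) (g : B6.Geometry) (δ₀ α : ℝ) :
    Ineq261 d g δ₀ α ↔ RowSum g (α * δ₀) (B6.c1 d δ₀ α) :=
  Iff.rfl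

/-- Row sums only improve with the rate (d ≥ 0). [folklore] -/
theorem RowSum.mono {σ σ' c : ℝ} (hd : ∀ a b : g.Site, 0 ≤ g.dist a b) (h : RowSum g σ c) (hσ : σ ≤ σ') :
    RowSum g σ' c := fun y =>
  (Finset.sum_le_sum fun y' _ => Real.exp_le_exp.mpr (by nlinarith [hd y y'])).trans (h y)

/-- The constant of a row sum is non-negative as soon as 𝔅 is non-empty. [folklore] -/
theorem RowSum.nonneg {σ c : ℝ} (h : RowSum g σ c) (y : g.Site) : 0 ≤ c :=
  (Finset.sum_nonneg fun _ _ => (Real.exp_pos _).le).trans (h y)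

/-- The convolution estimate behind every composition of Sect. G: if ρ ≤ ρ₂ and ρ + σ ≤ ρ₁ (ρ ≥ 0), then
Σ_{y″} e^{−ρ₁d(y,y″)}e^{−ρ₂d(y″,y′)} ≤ c·e^{−ρd(y,y′)} by d(y,y′) ≤ d(y,y″) + d(y″,y′) ((2.54) [3]) and the row sum at
rate σ. [cite: Balaban1984PropagatorsII, (2.54)–(2.56) p.233] -/
theorem conv_exp_le {ρ₁ ρ₂ ρ σ c : ℝ} (htri : Triangle254 g) (hd : ∀ a b : g.Site, 0 ≤ g.dist a b)
    (hrow : RowSum g σ c) (hρ : 0 ≤ ρ) (hρ₂ : ρ ≤ ρ₂) (hρ₁ : ρ + σ ≤ ρ₁) (y y' : g.Site) :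
    ∑ y'' : g.Site, Real.exp (-(ρ₁ * g.dist y y'')) * Real.exp (-(ρ₂ * g.dist y'' y')) ≤
      c * Real.exp (-(ρ * g.dist y y')) := by
  have hterm : ∀ y'' : g.Site,
      Real.exp (-(ρ₁ * g.dist y y'')) * Real.exp (-(ρ₂ * g.dist y'' y')) ≤
        Real.exp (-(σ * g.dist y y'')) * Real.exp (-(ρ * g.dist y y')) := by
    intro y''
    rw [← Real.exp_add, ← Real.exp_add]
    refine Real.exp_le_exp.mpr ?_
    have h1 : ρ * g.dist y y' ≤ ρ * g.dist y y'' + ρ * g.dist y'' y' := by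
      have := mul_le_mul_of_nonneg_left (htri y y'' y') hρ
      linarith [mul_add ρ (g.dist y y'') (g.dist y'' y')]
    have h2 : ρ * g.dist y'' y' ≤ ρ₂ * g.dist y'' y' := mul_le_mul_of_nonneg_right hρ₂ (hd _ _)
    have h3 : (ρ + σ) * g.dist y y'' ≤ ρ₁ * g.dist y y'' := mul_le_mul_of_nonneg_right hρ₁ (hd _ _)
    nlinarith
  calc ∑ y'' : g.Site, Real.exp (-(ρ₁ * g.dist y y'')) * Real.exp (-(ρ₂ * g.dist y'' y'))
      ≤ ∑ y'' : g.Site, Real.exp (-(σ * g.dist y y'')) * Real.exp (-(ρ * g.dist y y')) :=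
        Finset.sum_le_sum fun y'' _ => hterm y''
    _ = (∑ y'' : g.Site, Real.exp (-(σ * g.dist y y''))) * Real.exp (-(ρ * g.dist y y')) := by
        rw [Finset.sum_mul]
    _ ≤ c * Real.exp (-(ρ * g.dist y y')) := mul_le_mul_of_nonneg_right (hrow y) (Real.exp_nonneg _)

/-- **Composition with rates**: T₁ (majorant a₁e^{−ρ₁d}, F₂ → F₃) after T₂ (majorant a₂e^{−ρ₂d}, F₁ → F₂) has majorant
κ₂a₁a₂c·e^{−ρd} for every ρ ≥ 0 with ρ ≤ ρ₂, ρ + σ ≤ ρ₁ — the margin σ being the rate at which Lemma 2.1's row sum is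
used. [cite: Balaban1984PropagatorsII, (2.52)–(2.56) pp.232–233] -/
theorem hasMaj_comp_exp {b₁ : BlockNorm g F₁} {b₂ : BlockNorm g F₂} {b₃ : BlockNorm g F₃}
    {T₁ : F₂ →ₗ[ℝ] F₃} {T₂ : F₁ →ₗ[ℝ] F₂} {a₁ a₂ ρ₁ ρ₂ ρ σ c : ℝ}
    (htri : Triangle254 g) (hd : ∀ a b : g.Site, 0 ≤ g.dist a b) (hrow : RowSum g σ c)
    (ha₁ : 0 ≤ a₁) (ha₂ : 0 ≤ a₂) (hρ : 0 ≤ ρ) (hρ₂ : ρ ≤ ρ₂) (hρ₁ : ρ + σ ≤ ρ₁)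
    (h₁ : HasMaj b₂ b₃ T₁ (fun a b => a₁ * Real.exp (-(ρ₁ * g.dist a b))))
    (h₂ : HasMaj b₁ b₂ T₂ (fun a b => a₂ * Real.exp (-(ρ₂ * g.dist a b)))) :
    HasMaj b₁ b₃ (T₁ ∘ₗ T₂) (fun a b => b₂.κ * a₁ * a₂ * c * Real.exp (-(ρ * g.dist a b))) := by
  refine (hasMaj_comp h₁ h₂ fun a b => mul_nonneg ha₁ (Real.exp_nonneg _)).mono fun a b => ?_
  have hconv := conv_exp_le htri hd hrow hρ hρ₂ hρ₁ a b
  calc ∑ y'' : g.Site, a₁ * Real.exp (-(ρ₁ * g.dist a y'')) * (b₂.κ * (a₂ * Real.exp (-(ρ₂ * g.dist y'' b))))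
      = b₂.κ * a₁ * a₂ *
          ∑ y'' : g.Site, Real.exp (-(ρ₁ * g.dist a y'')) * Real.exp (-(ρ₂ * g.dist y'' b)) := by
        rw [Finset.mul_sum]; exact Finset.sum_congr rfl fun y'' _ => by ring
    _ ≤ b₂.κ * a₁ * a₂ * (c * Real.exp (-(ρ * g.dist a b))) :=
        mul_le_mul_of_nonneg_left hconv (mul_nonneg (mul_nonneg b₂.κ_nonneg ha₁) ha₂)
    _ = _ := by ring

/-- Composition with a CONSTANT majorant on the right (no decay): T₁ (majorant a₁e^{−ρ₁d}, ρ₁ ≥ σ) after T₂ (majorant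
the constant M) has the constant majorant κ₂a₁Mc. Used for the remainder of the Neumann series (188). [folklore] -/
theorem hasMaj_comp_const {b₁ : BlockNorm g F₁} {b₂ : BlockNorm g F₂} {b₃ : BlockNorm g F₃}
    {T₁ : F₂ →ₗ[ℝ] F₃} {T₂ : F₁ →ₗ[ℝ] F₂} {a₁ M ρ₁ σ c : ℝ}
    (hd : ∀ a b : g.Site, 0 ≤ g.dist a b) (hrow : RowSum g σ c) (ha₁ : 0 ≤ a₁) (hM : 0 ≤ M) (hρ₁ : σ ≤ ρ₁)
    (h₁ : HasMaj b₂ b₃ T₁ (fun a b => a₁ * Real.exp (-(ρ₁ * g.dist a b))))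
    (h₂ : HasMaj b₁ b₂ T₂ (fun _ _ => M)) :
    HasMaj b₁ b₃ (T₁ ∘ₗ T₂) (fun _ _ => b₂.κ * a₁ * M * c) := by
  refine (hasMaj_comp h₁ h₂ fun a b => mul_nonneg ha₁ (Real.exp_nonneg _)).mono fun a b => ?_
  have hrow' : RowSum g ρ₁ c := hrow.mono hd hρ₁
  calc ∑ y'' : g.Site, a₁ * Real.exp (-(ρ₁ * g.dist a y'')) * (b₂.κ * M)
      = b₂.κ * a₁ * M * ∑ y'' : g.Site, Real.exp (-(ρ₁ * g.dist a y'')) := by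
        rw [Finset.mul_sum]; exact Finset.sum_congr rfl fun y'' _ => by ring
    _ ≤ b₂.κ * a₁ * M * c :=
        mul_le_mul_of_nonneg_left (hrow' a) (mul_nonneg (mul_nonneg b₂.κ_nonneg ha₁) hM)

/-! ## *"(188) and Lemma 2.1"*: the Neumann series over block majorants -/

/-- (188), algebra: if 𝔄₀ = S + K′𝔄₀ then 𝔄₀μ = Σ_{n<N} K′ⁿSμ + K′ᴺ𝔄₀μ for every N. [cite: Balaban1985Variational, (188) p.308] -/
theorem neumann_telescope {K' : Module.End ℝ F₂} {S A0 : F₁ →ₗ[ℝ] F₂} (hfix : A0 = S + K' ∘ₗ A0) (N : ℕ)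
    (μ : F₁) : A0 μ = (∑ n ∈ Finset.range N, (K' ^ n) (S μ)) + (K' ^ N) (A0 μ) := by
  have hpt : ∀ ν : F₁, A0 ν = S ν + K' (A0 ν) := fun ν => by
    conv_lhs => rw [hfix]
    rfl
  induction N with
  | zero => simp
  | succ N ih =>
      have hstep : (K' ^ N) (S μ) + (K' ^ (N + 1)) (A0 μ) = (K' ^ N) (A0 μ) := by
        conv_rhs => rw [hpt μ]
        rw [map_add, pow_succ, Module.End.mul_apply]
      rw [Finset.sum_range_succ, add_assoc, hstep]
      exact ih

/-- **"(188) and Lemma 2.1"** (p. 308), KERNEL-CHECKED over block majorants.  Let 𝔄₀ : F₁ → F₂ satisfy the linear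
equation 𝔄₀ = S + K′𝔄₀ ((184) with K′ = −G̃((δ²/δA′²)V)(𝒜₀ + H₀B), S its right-hand side), where K′ has majorant
θe^{−δd} and S has majorant Ae^{−ρd} with ρ + σ ≤ δ, and suppose 𝔄₀ is A PRIORI BOUNDED — majorant the constant M₀,
which is what the norm convergence of the Neumann series (188) under the smallness (187) gives.  If the row sum of
Lemma 2.1 [3] holds at the rate σ with constant c and q := κ₂θc < 1, then 𝔄₀ has the DECAYING majorant
A(1 − q)⁻¹e^{−ρd(y,y′)}: the n-th term K′ⁿS has majorant qⁿAe^{−ρd} (n uses of (2.54) + (2.61)), the remainder K′ᴺ𝔄₀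
has majorant qᴺM₀ → 0.  For (189)–(190): δ = ¼δ₀, ρ = σ = ⅛δ₀ (α = ½ of [3] p. 234).
[cite: Balaban1985Variational, (187)–(190) p.308; Balaban1984PropagatorsII, Lemma 2.1 p.234] -/
theorem neumann_majorant {b₁ : BlockNorm g F₁} {b₂ : BlockNorm g F₂} {K' : Module.End ℝ F₂}
    {S A0 : F₁ →ₗ[ℝ] F₂} {θ A M₀ δ ρ σ c : ℝ}
    (htri : Triangle254 g) (hd : ∀ a b : g.Site, 0 ≤ g.dist a b) (hrow : RowSum g σ c)
    (hθ : 0 ≤ θ) (hA : 0 ≤ A) (hM₀ : 0 ≤ M₀) (hρ : 0 ≤ ρ) (hρδ : ρ + σ ≤ δ)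
    (hK : HasMaj b₂ b₂ K' (fun a b => θ * Real.exp (-(δ * g.dist a b))))
    (hS : HasMaj b₁ b₂ S (fun a b => A * Real.exp (-(ρ * g.dist a b))))
    (hfix : A0 = S + K' ∘ₗ A0) (hap : HasMaj b₁ b₂ A0 (fun _ _ => M₀))
    (hq : b₂.κ * θ * c < 1) :
    HasMaj b₁ b₂ A0 (fun a b => A * (1 - b₂.κ * θ * c)⁻¹ * Real.exp (-(ρ * g.dist a b))) := by
  set q : ℝ := b₂.κ * θ * c with hqdef
  have hc : 0 ≤ c ∨ IsEmpty g.Site := by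
    by_cases hne : Nonempty g.Site
    · exact Or.inl (hrow.nonneg (Classical.arbitrary _))
    · exact Or.inr (not_nonempty_iff.mp hne)
  intro y' μ hμ y
  -- if 𝔅 is empty there is nothing to prove (no y); otherwise 0 ≤ c
  rcases hc with hc | hemp
  swap
  · exact (IsEmpty.false y).elim
  have hq0 : 0 ≤ q := mul_nonneg (mul_nonneg b₂.κ_nonneg hθ) hc
  -- (1) the n-th term K′ⁿ S has majorant qⁿ A e^{−ρd}
  have hterm : ∀ n : ℕ, HasMaj b₁ b₂ ((K' ^ n) ∘ₗ S)
      (fun a b => q ^ n * A * Real.exp (-(ρ * g.dist a b))) := by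
    intro n
    induction n with
    | zero =>
        refine hS.congr ?_ |>.mono ?_
        · intro ν; simp
        · intro a b; simp
    | succ n ih =>
        have hstep := hasMaj_comp_exp (b₁ := b₁) (b₂ := b₂) (b₃ := b₂) (T₁ := K') (T₂ := (K' ^ n) ∘ₗ S)
          htri hd hrow hθ (mul_nonneg (pow_nonneg hq0 n) hA) hρ le_rfl hρδ hK ih
        refine (hstep.congr fun ν => ?_).mono fun a b => ?_
        · simp [pow_succ', Module.End.mul_apply]
        · have : b₂.κ * θ * (q ^ n * A) * c = q ^ (n + 1) * A := by rw [hqdef]; ring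
          rw [this]
  -- (2) the partial sums
  have hpartial : ∀ N : ℕ, HasMaj b₁ b₂ (∑ n ∈ Finset.range N, (K' ^ n) ∘ₗ S)
      (fun a b => ∑ n ∈ Finset.range N, q ^ n * A * Real.exp (-(ρ * g.dist a b))) := fun N =>
    hasMaj_sum (fun n => (K' ^ n) ∘ₗ S) _ hterm N
  -- (3) the remainder K′ᴺ 𝔄₀ has the constant majorant qᴺ M₀
  have hrem : ∀ N : ℕ, HasMaj b₁ b₂ ((K' ^ N) ∘ₗ A0) (fun _ _ => q ^ N * M₀) := by
    intro N
    induction N with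
    | zero =>
        refine hap.congr ?_ |>.mono ?_
        · intro ν; simp
        · intro a b; simp
    | succ N ih =>
        have hstep := hasMaj_comp_const (b₁ := b₁) (b₂ := b₂) (b₃ := b₂) (T₁ := K') (T₂ := (K' ^ N) ∘ₗ A0)
          hd hrow hθ (mul_nonneg (pow_nonneg hq0 N) hM₀) (by linarith) hK ih
        refine (hstep.congr fun ν => ?_).mono fun a b => ?_
        · simp [pow_succ', Module.End.mul_apply]
        · have : b₂.κ * θ * (q ^ N * M₀) * c = q ^ (N + 1) * M₀ := by rw [hqdef]; ring
          rw [this]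
  -- (4) for every N: loc y (𝔄₀μ) ≤ C + qᴺ M₀ loc y′ μ
  set C : ℝ := A * (1 - q)⁻¹ * Real.exp (-(ρ * g.dist y y')) * b₁.loc y' μ with hC
  have hgeomC : ∀ N : ℕ,
      (∑ n ∈ Finset.range N, q ^ n * A * Real.exp (-(ρ * g.dist y y'))) * b₁.loc y' μ ≤ C := by
    intro N
    have hgeom : ∑ n ∈ Finset.range N, q ^ n ≤ (1 - q)⁻¹ :=
      sum_le_hasSum (Finset.range N) (fun n _ => pow_nonneg hq0 n) (hasSum_geometric_of_lt_one hq0 hq)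
    have hnn : 0 ≤ A * Real.exp (-(ρ * g.dist y y')) * b₁.loc y' μ :=
      mul_nonneg (mul_nonneg hA (Real.exp_nonneg _)) (b₁.loc_nonneg _ _)
    calc (∑ n ∈ Finset.range N, q ^ n * A * Real.exp (-(ρ * g.dist y y'))) * b₁.loc y' μ
        = (∑ n ∈ Finset.range N, q ^ n) * (A * Real.exp (-(ρ * g.dist y y')) * b₁.loc y' μ) := by
          rw [Finset.sum_mul, Finset.sum_mul]; exact Finset.sum_congr rfl fun n _ => by ring
      _ ≤ (1 - q)⁻¹ * (A * Real.exp (-(ρ * g.dist y y')) * b₁.loc y' μ) :=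
          mul_le_mul_of_nonneg_right hgeom hnn
      _ = C := by rw [hC]; ring
  have hN : ∀ N : ℕ, b₂.loc y (A0 μ) ≤ C + M₀ * b₁.loc y' μ * q ^ N := by
    intro N
    rw [neumann_telescope hfix N μ]
    refine (b₂.loc_add_le y _ _).trans (add_le_add ?_ ?_)
    · have h1 := hpartial N y' μ hμ y
      rw [LinearMap.sum_apply] at h1
      simp only [LinearMap.comp_apply] at h1
      exact h1.trans (hgeomC N)
    · have h2 := hrem N y' μ hμ y
      rw [LinearMap.comp_apply] at h2
      calc b₂.loc y ((K' ^ N) (A0 μ)) ≤ q ^ N * M₀ * b₁.loc y' μ := h2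
        _ = M₀ * b₁.loc y' μ * q ^ N := by ring
  -- (5) N → ∞
  have hlim : Filter.Tendsto (fun N : ℕ => C + M₀ * b₁.loc y' μ * q ^ N) Filter.atTop
      (nhds (C + M₀ * b₁.loc y' μ * 0)) :=
    ((tendsto_pow_atTop_nhds_zero_of_lt_one hq0 hq).const_mul (M₀ * b₁.loc y' μ)).const_add C
  rw [mul_zero, add_zero] at hlim
  have := ge_of_tendsto' hlim hN
  simpa [hC, hqdef, mul_assoc] using this


/-! ## Sect. G, pp. 307–309: (182)–(190) named, and the printed inference (189) + (188) + Lemma 2.1 ⇒ (190)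

The data of pp. 307–308 over three block-normed spaces on the same multiscale set 𝔅_k: `FB` = the 𝔤ᶜ-valued
configurations B on 𝔅_k (p. 307: B = (1/i) log V′; local size `bB.loc y′ B` = sup of |B| at the bonds of y′ — for the
unit configuration at one point y′ ∈ Λ_{j′} the η-scale pairing on 𝔅_k contributes the factor (L^{j′}η)^{−d} of (190));
`FA` = the vector fields 𝔄 on Ω₀ with the size of p. 308, N(𝔄) = max{|𝔄|_{(−1)}, |∇𝔄|_{(−2)}} localised to Δ̃(y)
(`bN`), or with the stronger local size adding (L^jη)³|D^{η*}_{U_k}D^η_{U_k}·|, (L^jη)³|Δ^η_{U_k}·| (and the Hölder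
quotient (L^jη)^{2+β}·‖ζ∇·‖_β/(‖ζ‖^#_β + |ζ|)) of the last three entries of (190) (`bN₂`); `F3` = the same fields with
the size |·|_{(−3)} of (186), (189) localised to Δ(y) (`b3`).  Operators (all ℝ-linear; the complex structure plays
no role in the bookkeeping): `Gt` = G̃ = GP₀* of (131)/(143) with G = (Δ_a − Δ^{(2)})⁻¹ (p. 306); `W` = the kernel
((δ²/δA′²)V)(𝒜₀ + H₀B) of (184) *"treated as a kernel of a linear operator"*; `D2H0` = Δ^{(2)}H₀; `H0` = H₀ of (129);
`H` = H of (45)–(46); `Dfr` = 𝔇(𝒜₀ + H₀B), 𝔇 = (δ/δA′)D of (70)–(73); `A0` = 𝔄₀ = (δ/δB)𝒜₀ (p. 307: *"Let us denote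
𝔄₀(b, c) = (δ/δB(c))𝒜₀(B, b)"*); `dH` = (δ/δB)𝓗(B).  δ₀ = the decay rate printed in (73), (130), (161), (189), (190).
-/

section SectG

variable {FB FA F3 : Type} [AddCommGroup FB] [Module ℝ FB] [AddCommGroup FA] [Module ℝ FA]
  [AddCommGroup F3] [Module ℝ F3]

/-- **(182)** (p. 307 [31], verbatim): *"The functional derivative (δ/δB)𝓗(B) satisfies a linear equation obtained by
differentiations of the equations determining 𝓗(B). For example we consider Eqs. (179), (180). Differentiation of (179)
yields (δ/δB)𝓗 = (δ/δB)𝒜₀ + H₀ − H⟨𝔇(𝒜₀ + H₀B), (δ/δB)𝒜₀ + H₀⟩, (182) where the last scalar product is with respect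
to bonds in Ω₀ in η-scale."* — typed as the operator identity δ𝓗 = (𝔄₀ + H₀) − H·𝔇(𝒜₀ + H₀B)·(𝔄₀ + H₀) (the scalar
product over the bonds of Ω₀ IS the composition with the linear operator 𝔇(𝒜₀ + H₀B) = (δ/δA′)D at A′ = 𝒜₀ + H₀B;
chain rule on (179) 𝓗 = 𝒜₀ + H₀B − HD(𝒜₀ + H₀B)). [cite: Balaban1985Variational, (182) p.307] -/
def Eq182 (dH A0 H0 H : FB →ₗ[ℝ] FA) (Dfr : FA →ₗ[ℝ] FB) : Prop :=
  dH = (A0 + H0) - H ∘ₗ (Dfr ∘ₗ (A0 + H0))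

/-- **(183)–(184)** (p. 307 [31], verbatim): *"Differentiation of (180) yields (δ/δB)𝒜₀ + G̃⟨((δ²/δA′²)V)(𝒜₀ + H₀B),
(δ/δB)𝒜₀ + H₀⟩ = G̃Δ^{(2)}H₀ (183) Let us denote 𝔄₀(b, c) = (δ/δB(c))𝒜₀(B, b). We may fix a bond c ∈ 𝔅_k and
consider the above equation as an equation for the function 𝔄₀(·, c). This equation can be written as
(I + G̃((δ²/δA′²)V)(𝒜₀ + H₀B))𝔄₀ = G̃Δ^{(2)}H₀ − G̃((δ²/δA′²)V)(𝒜₀ + H₀B)H₀, (184) where the derivative (δ²/δA′²)V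
is treated as a kernel of a linear operator."* — typed: 𝔄₀ + (G̃W)𝔄₀ = G̃Δ^{(2)}H₀ − (G̃W)H₀ with W =
((δ²/δA′²)V)(𝒜₀ + H₀B). [cite: Balaban1985Variational, (183)–(184) p.307] -/
def Eq184 (A0 H0 : FB →ₗ[ℝ] FA) (Gt : F3 →ₗ[ℝ] FA) (W : FA →ₗ[ℝ] F3) (D2H0 : FB →ₗ[ℝ] F3) : Prop :=
  A0 + (Gt ∘ₗ W) ∘ₗ A0 = Gt ∘ₗ D2H0 - (Gt ∘ₗ W) ∘ₗ H0

/-- **(185)–(188)** (p. 308 [32]): (185) the Cauchy formula for ((δ²/δA′²)V)(A′)𝔄 with *"r = max{|A′|_{(−1)},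
|∇A′|_{(−2)}}(max{|𝔄|_{(−1)}, |∇𝔄|_{(−2)}})⁻¹"*; (186) verbatim: *"we get from Proposition 4
|((δ²/δA′²)V)(A′)𝔄|_{(−3)} ≤ 4C₄ε₃ max{|𝔄|_{(−1)}, |∇𝔄|_{(−2)}}. (186) This implies the bound
|G̃((δ²/δA′²)V)(𝒜₀ + H₀B)𝔄|_{(−1)}, |∇G̃((δ²/δA′²)V)(𝒜₀ + H₀B)𝔄|_{(−2)} ≤ O(1)B₀C₄B₅ε₁ max{|𝔄|_{(−1)}, |∇𝔄|_{(−2)}}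
(187) for ε₁ sufficiently small, hence the norm of the linear operator is small also. Thus Eq. (184) can be solved by
the Neumann series expansion 𝔄₀ = (I + G̃((δ²/δA′²)V)(𝒜₀ + H₀B))⁻¹(G̃Δ^{(2)}H₀ − G̃((δ²/δA′²)V)(𝒜₀ + H₀B)H₀) (188)"*.
TYPED CONSEQUENCE used below (the only thing (187)–(188) contribute to (190)): the solution operator B ↦ 𝔄₀ is A PRIORI
BOUNDED from the B-size to the N-size — majorant the CONSTANT M₀ (no decay claimed), M₀ = (1 − O(1)B₀C₄B₅ε₁)⁻¹ ×
(the norm of the right-hand side of (184)) under the smallness O(1)B₀C₄B₅ε₁ < 1 of (187).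
[cite: Balaban1985Variational, (185)–(188) p.308] -/
def Bound188 (bB : BlockNorm g FB) (bN : BlockNorm g FA) (A0 : FB →ₗ[ℝ] FA) (M₀ : ℝ) : Prop :=
  HasMaj bB bN A0 (fun _ _ => M₀)

/-- **(189)** (p. 308 [32]) — THE LOCATED, AUTHOR-OMITTED INPUT (cell GAPS G-B11-G2).  Verbatim: *"To prove an
exponential decay we have to investigate more closely the kernel ((δ²/δA′²)V)(A′). This is, unfortunately, a very
awkward and complicated problem, although quite straightforward. Already the first derivative of V is complicated and
given by many formulas, see (85), (88), (89), (90), (93). Now we have to differentiate those expressions second time. We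
do not perform these calculations here, we have obtained all necessary results to do the calculations and estimates, let
us formulate a final result only. We have |Δ(y)(δ²/δA′²)V(A′)𝔄| ≤ O(1)ε₃(L^jη)^{−3} exp(−¼δ₀d(y,y′)) max{|𝔄|_{(−1)},
|∇𝔄|_{(−2)}}, (189) for supp 𝔄 ⊂ Δ̃(y′), A′ satisfying (77), y ∈ Λ_j."* — typed at A′ = 𝒜₀ + H₀B (the only instance
(184) uses) as: W has majorant θ_W·e^{−¼δ₀d(y,y′)} from the N-size to the |·|_{(−3)}-size, θ_W = O(1)ε₃.  NOT PROVED
here or anywhere in print. [cite: Balaban1985Variational, (189) p.308] -/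
def Ineq189 (bN : BlockNorm g FA) (b3 : BlockNorm g F3) (W : FA →ₗ[ℝ] F3) (θW δ₀ : ℝ) : Prop :=
  HasMaj bN b3 W (fun y y' => θW * Real.exp (-(δ₀ / 4 * g.dist y y')))

/-- **(190)** (p. 308 [32], verbatim): *"This inequality, the formula (188) and Lemma 2.1, and finally Proposition 2 and
(181), yield |(δ/δB_ν(y′))𝓗_μ(B,x)|, |∇_x(δ/δB_ν(y′))𝓗_μ(B,x)|, ‖ζ∇(δ/δB(y′))𝓗(B)‖_β, |D^{η*}_{U_k}D^η_{U_k}(δ/δB_ν(y))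
𝓗_μ(B,x)|, |Δ^η_{U_k}(δ/δB_ν(y′))𝓗_μ(B,x)| ≤ O(1)[(L^jη)^{−1}, (L^jη)^{−2}, (‖ζ‖^#_β + |ζ|)(L^jη)^{−2−β}, (L^jη)^{−3},
(L^jη)^{−3}]·(L^{j′}η)^{−d} exp(−⅛δ₀d(y,y′)) (190) for x ∈ Δ(y), or supp ζ ⊂ Δ̃(y), y ∈ Λ_j, y′ ∈ Λ_{j′}."* — typed as:
δ𝓗 has majorant C·e^{−⅛δ₀d(y,y′)} from the B-size into the local size `bout` of the fields: with `bout` = the N-size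
this is the pair of entries n = 0, 1 of `B11.pref190` (scale weights and (L^{j′}η)^{−d} inside the sizes, see the
section docstring); with `bout` = the second-order / Hölder local size it is the entries n = 3, 4 / n = 2.  The words
*"and finally Proposition 2 and (181)"* (transport from the base point U₀ = U_k(V₀) to a general B in the domain (170))
are NOT typed (cell GAPS G-B11-G2a). [cite: Balaban1985Variational, (190) p.308] -/
def Ineq190 (bB : BlockNorm g FB) (bout : BlockNorm g FA) (dH : FB →ₗ[ℝ] FA) (C δ₀ : ℝ) : Prop :=
  HasMaj bB bout dH (fun y y' => C * Real.exp (-(δ₀ / 8 * g.dist y y')))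

/-! ### The constants (every O(1) of the chain explicit) -/

/-- Majorant constant of K = G̃W (rate ¼δ₀): κ₃·B_G·θ_W·c. [cite: Balaban1985Variational, (187) p.308] -/
def thetaK (κ₃ BG θW c : ℝ) : ℝ := κ₃ * BG * θW * c

/-- Majorant constant of the right-hand side S = G̃Δ^{(2)}H₀ − (G̃W)H₀ of (184) (rate ⅛δ₀). [cite: Balaban1985Variational, (184) p.307] -/
def constS (κ₃ κN BG θW cΔ A₀ c : ℝ) : ℝ := κ₃ * BG * cΔ * c + κN * thetaK κ₃ BG θW c * A₀ * c

/-- The ratio of the Neumann series (188) over block majorants: q = κ_N·θ_K·c (Lemma 2.1 used with the summable factor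
e^{−⅛δ₀d}); the LOCATED smallness is q < 1 (*"for ε₁ sufficiently small"* of (187): θ_W = O(1)ε₃, ε₃ = O(1)B₅ε₁).
[cite: Balaban1985Variational, (187)–(188) p.308] -/
def qG (κ₃ κN BG θW c : ℝ) : ℝ := κN * thetaK κ₃ BG θW c * c

/-- Majorant constant of 𝔄₀ = (δ/δB)𝒜₀ (rate ⅛δ₀): constS·(1 − q)⁻¹. [cite: Balaban1985Variational, (188)–(190) p.308] -/
noncomputable def constA0 (κ₃ κN BG θW cΔ A₀ c : ℝ) : ℝ :=
  constS κ₃ κN BG θW cΔ A₀ c * (1 - qG κ₃ κN BG θW c)⁻¹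

/-- The O(1) of (190), entries n = 0, 1: (C_𝔄 + A₀)·(1 + κ_B·A_H·κ_N·θ_𝔇·c²) via (182). [cite: Balaban1985Variational, (190) p.308] -/
noncomputable def const190 (κB κN κ₃ BG θW cΔ A₀ AH θD c : ℝ) : ℝ :=
  (constA0 κ₃ κN BG θW cΔ A₀ c + A₀) * (1 + κB * AH * κN * θD * c * c)

/-- θ_K ≥ 0 for non-negative data. [folklore] -/
theorem thetaK_nonneg {κ₃ BG θW c : ℝ} (h₁ : 0 ≤ κ₃) (h₂ : 0 ≤ BG) (h₃ : 0 ≤ θW) (h₄ : 0 ≤ c) :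
    0 ≤ thetaK κ₃ BG θW c := by unfold thetaK; positivity

/-- constS ≥ 0 for non-negative data. [folklore] -/
theorem constS_nonneg {κ₃ κN BG θW cΔ A₀ c : ℝ} (h₁ : 0 ≤ κ₃) (h₂ : 0 ≤ κN) (h₃ : 0 ≤ BG) (h₄ : 0 ≤ θW)
    (h₅ : 0 ≤ cΔ) (h₆ : 0 ≤ A₀) (h₇ : 0 ≤ c) : 0 ≤ constS κ₃ κN BG θW cΔ A₀ c := by
  unfold constS
  have := thetaK_nonneg h₁ h₃ h₄ h₇
  positivity

/-- constA0 ≥ 0 for non-negative data under the smallness q < 1. [folklore] -/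
theorem constA0_nonneg {κ₃ κN BG θW cΔ A₀ c : ℝ} (h₁ : 0 ≤ κ₃) (h₂ : 0 ≤ κN) (h₃ : 0 ≤ BG) (h₄ : 0 ≤ θW)
    (h₅ : 0 ≤ cΔ) (h₆ : 0 ≤ A₀) (h₇ : 0 ≤ c) (hq : qG κ₃ κN BG θW c < 1) : 0 ≤ constA0 κ₃ κN BG θW cΔ A₀ c := by
  unfold constA0
  exact mul_nonneg (constS_nonneg h₁ h₂ h₃ h₄ h₅ h₆ h₇) (inv_nonneg.mpr (by linarith))

/-! ### The kernel-checked chain -/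

/-- Rates only get worse: a majorant a·e^{−ρ′d} is also a majorant a·e^{−ρd} for ρ ≤ ρ′ (a ≥ 0, d ≥ 0). [folklore] -/
theorem HasMaj.of_rate_le {F₁' F₂' : Type} [AddCommGroup F₁'] [Module ℝ F₁'] [AddCommGroup F₂'] [Module ℝ F₂']
    {b₁ : BlockNorm g F₁'} {b₂ : BlockNorm g F₂'} {T : F₁' →ₗ[ℝ] F₂'} {a ρ ρ' : ℝ}
    (hd : ∀ x y : g.Site, 0 ≤ g.dist x y) (ha : 0 ≤ a) (hρ : ρ ≤ ρ')
    (h : HasMaj b₁ b₂ T (fun y y' => a * Real.exp (-(ρ' * g.dist y y')))) :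
    HasMaj b₁ b₂ T (fun y y' => a * Real.exp (-(ρ * g.dist y y'))) :=
  h.mono fun y y' => mul_le_mul_of_nonneg_left (Real.exp_le_exp.mpr (by nlinarith [hd y y'])) ha

/-- **𝔄₀ = (δ/δB)𝒜₀ decays at the rate ⅛δ₀** — the content of *"This inequality [(189)], the formula (188) and Lemma
2.1"* for the solution of (184): K = G̃W has majorant θ_K e^{−¼δ₀d} (G̃ at rate δ₀ composed with (189) at rate ¼δ₀,
margin ¾δ₀ ≥ ⅛δ₀), the right-hand side of (184) has majorant constS·e^{−⅛δ₀d}, and `neumann_majorant` with δ = ¼δ₀,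
ρ = σ = ⅛δ₀ gives the majorant constA0·e^{−⅛δ₀d}, PROVIDED q = κ_N θ_K c < 1.  Inputs, each a hypothesis of the
printed shape: `hG` = the kernel bound of G̃ = GP₀* (p. 306: *"the new operator G has exactly the same properties as
Δ_a⁻¹"*, i.e. [5] Thm 3.3 (3.42) for Δ_a⁻¹ — cell GAPS G-B11-G1); `h189`; `hD2H0` = Δ^{(2)}H₀ from (130) (p. 297:
*"|(Δ_{U₀}H₀,μν)(x,y′)| ≤ B₀(L^jη)^{−3}(L^{j′}η)^{−d}e^{−δ₀d(y,y′)}"*) and the O(|∂U₀ − 1|) coefficients of Δ^{(2)}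
((38)–(40)); `hH0` = (129) with *"the bound (3.133) [5]"*; `h184`; `h188`; the row sum of Lemma 2.1 [3] with the
summable factor e^{−⅛δ₀d}; the triangle inequality (2.54) [3]; d ≥ 0; δ₀ ≥ 0.
[cite: Balaban1985Variational, (184)–(190) pp.307–308] -/
theorem A0_majorant_of_189 {bB : BlockNorm g FB} {bN : BlockNorm g FA} {b3 : BlockNorm g F3}
    {Gt : F3 →ₗ[ℝ] FA} {W : FA →ₗ[ℝ] F3} {D2H0 : FB →ₗ[ℝ] F3} {H0 A0 : FB →ₗ[ℝ] FA}
    {δ₀ BG θW cΔ A₀ M₀ c : ℝ}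
    (htri : Triangle254 g) (hd : ∀ a b : g.Site, 0 ≤ g.dist a b) (hδ₀ : 0 ≤ δ₀) (hrow : RowSum g (δ₀ / 8) c)
    (hc : 0 ≤ c) (hBG : 0 ≤ BG) (hθW : 0 ≤ θW) (hcΔ : 0 ≤ cΔ) (hA₀ : 0 ≤ A₀) (hM₀ : 0 ≤ M₀)
    (hG : HasMaj b3 bN Gt (fun y y' => BG * Real.exp (-(δ₀ * g.dist y y'))))
    (h189 : Ineq189 bN b3 W θW δ₀)
    (hD2H0 : HasMaj bB b3 D2H0 (fun y y' => cΔ * Real.exp (-(δ₀ * g.dist y y'))))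
    (hH0 : HasMaj bB bN H0 (fun y y' => A₀ * Real.exp (-(δ₀ * g.dist y y'))))
    (h184 : Eq184 A0 H0 Gt W D2H0) (h188 : Bound188 bB bN A0 M₀)
    (hq : qG b3.κ bN.κ BG θW c < 1) :
    HasMaj bB bN A0 (fun y y' => constA0 b3.κ bN.κ BG θW cΔ A₀ c * Real.exp (-(δ₀ / 8 * g.dist y y'))) := by
  have hθK : 0 ≤ thetaK b3.κ BG θW c := thetaK_nonneg b3.κ_nonneg hBG hθW hc
  -- K = G̃W : rate ¼δ₀
  have hK : HasMaj bN bN (Gt ∘ₗ W) (fun y y' => thetaK b3.κ BG θW c * Real.exp (-(δ₀ / 4 * g.dist y y'))) := by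
    have := hasMaj_comp_exp (ρ := δ₀ / 4) htri hd hrow hBG hθW (by linarith) le_rfl (by linarith) hG h189
    simpa [thetaK] using this
  -- the right-hand side of (184): rate ⅛δ₀
  have hS₁ : HasMaj bB bN (Gt ∘ₗ D2H0)
      (fun y y' => b3.κ * BG * cΔ * c * Real.exp (-(δ₀ / 8 * g.dist y y'))) :=
    hasMaj_comp_exp (ρ := δ₀ / 8) htri hd hrow hBG hcΔ (by linarith) (by linarith) (by linarith) hG hD2H0
  have hS₂ : HasMaj bB bN ((Gt ∘ₗ W) ∘ₗ H0)
      (fun y y' => bN.κ * thetaK b3.κ BG θW c * A₀ * c * Real.exp (-(δ₀ / 8 * g.dist y y'))) :=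
    hasMaj_comp_exp (ρ := δ₀ / 8) htri hd hrow hθK hA₀ (by linarith) (by linarith) (by linarith) hK hH0
  have hS : HasMaj bB bN (Gt ∘ₗ D2H0 - (Gt ∘ₗ W) ∘ₗ H0)
      (fun y y' => constS b3.κ bN.κ BG θW cΔ A₀ c * Real.exp (-(δ₀ / 8 * g.dist y y'))) :=
    (hS₁.sub hS₂).mono fun y y' => by unfold constS; exact le_of_eq (by ring)
  -- (184) as a fixed-point equation 𝔄₀ = S + K′𝔄₀ with K′ = −G̃W
  have hfix : A0 = (Gt ∘ₗ D2H0 - (Gt ∘ₗ W) ∘ₗ H0) + (-(Gt ∘ₗ W)) ∘ₗ A0 := by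
    rw [LinearMap.neg_comp, ← sub_eq_add_neg, eq_sub_iff_add_eq]
    exact h184
  have hmain := neumann_majorant (b₁ := bB) (b₂ := bN) (K' := -(Gt ∘ₗ W)) (δ := δ₀ / 4) (ρ := δ₀ / 8)
    (σ := δ₀ / 8) htri hd hrow hθK (constS_nonneg b3.κ_nonneg bN.κ_nonneg hBG hθW hcΔ hA₀ hc) hM₀
    (by linarith) (by linarith) hK.neg hS hfix h188 (by simpa [qG] using hq)
  refine hmain.mono fun y y' => le_of_eq ?_
  simp [constA0, qG, mul_assoc]

/-- **(182) transports majorants**: if 𝔄₀ and H₀ have majorants into a local size `bout` and into the N-size, 𝔇(𝒜₀ +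
H₀B) has the (73)-majorant θ_𝔇e^{−½δ₀d} from the N-size (p. 289: *"|𝔇(A′; c, b)| ≤ O(1)C₃ε₃(L^jη)^{−d+1}
e^{−(1/2)δ₀d(c₋,y)}, b ∈ B^j(y), y ∈ Λ_j"*), and H has a majorant A_He^{−½δ₀d} into `bout` ((46) with the kernel
decay used in (161): *"|HB|, |∇^ηHB|, |∂^{η*}∂^ηHB|, |Δ^ηHB| ≤ B₀Σ_{c∈ℭ_k}e^{−δ₀d(y₁,c₋)}(L^{j(c)}η)^{−1}|B(c)|"*, [5]
Thm 3.12), then δ𝓗 = (𝔄₀ + H₀) − H𝔇(𝔄₀ + H₀) has the majorant [(C′ + A′₀) + κ_B A_H κ_N θ_𝔇 (C + A₀)c²]·e^{−⅛δ₀d}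
into `bout`. [cite: Balaban1985Variational, (182) p.307 + (73) p.289 + (161) p.303] -/
theorem dH_majorant_of_182 {bB : BlockNorm g FB} {bN bout : BlockNorm g FA}
    {H0 H A0 dH : FB →ₗ[ℝ] FA} {Dfr : FA →ₗ[ℝ] FB} {δ₀ C A₀ C' A₀' AH θD c : ℝ}
    (htri : Triangle254 g) (hd : ∀ a b : g.Site, 0 ≤ g.dist a b) (hδ₀ : 0 ≤ δ₀) (hrow : RowSum g (δ₀ / 8) c)
    (hC : 0 ≤ C) (hA₀ : 0 ≤ A₀) (hA₀' : 0 ≤ A₀') (hAH : 0 ≤ AH) (hθD : 0 ≤ θD)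
    (hA0 : HasMaj bB bN A0 (fun y y' => C * Real.exp (-(δ₀ / 8 * g.dist y y'))))
    (hH0 : HasMaj bB bN H0 (fun y y' => A₀ * Real.exp (-(δ₀ * g.dist y y'))))
    (hA0' : HasMaj bB bout A0 (fun y y' => C' * Real.exp (-(δ₀ / 8 * g.dist y y'))))
    (hH0' : HasMaj bB bout H0 (fun y y' => A₀' * Real.exp (-(δ₀ * g.dist y y'))))
    (hH : HasMaj bB bout H (fun y y' => AH * Real.exp (-(δ₀ / 2 * g.dist y y'))))
    (hDfr : HasMaj bN bB Dfr (fun y y' => θD * Real.exp (-(δ₀ / 2 * g.dist y y'))))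
    (h182 : Eq182 dH A0 H0 H Dfr) :
    Ineq190 bB bout dH ((C' + A₀') + bB.κ * AH * (bN.κ * θD * (C + A₀) * c) * c) δ₀ := by
  -- 𝔄₀ + H₀ into the N-size and into bout, both at rate ⅛δ₀
  have hsumN : HasMaj bB bN (A0 + H0) (fun y y' => (C + A₀) * Real.exp (-(δ₀ / 8 * g.dist y y'))) :=
    (hA0.add (hH0.of_rate_le (ρ := δ₀ / 8) hd hA₀ (by linarith))).mono fun y y' => le_of_eq (by ring)
  have hsum' : HasMaj bB bout (A0 + H0) (fun y y' => (C' + A₀') * Real.exp (-(δ₀ / 8 * g.dist y y'))) :=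
    (hA0'.add (hH0'.of_rate_le (ρ := δ₀ / 8) hd hA₀' (by linarith))).mono fun y y' => le_of_eq (by ring)
  -- 𝔇(𝔄₀ + H₀): rate ⅛δ₀ (margin ⅜δ₀ ≥ ⅛δ₀)
  have hinner : HasMaj bB bB (Dfr ∘ₗ (A0 + H0))
      (fun y y' => bN.κ * θD * (C + A₀) * c * Real.exp (-(δ₀ / 8 * g.dist y y'))) :=
    hasMaj_comp_exp (ρ := δ₀ / 8) htri hd hrow hθD (add_nonneg hC hA₀) (by linarith) le_rfl (by linarith) hDfr hsumN
  -- H𝔇(𝔄₀ + H₀): rate ⅛δ₀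
  have hc : 0 ≤ c ∨ IsEmpty g.Site := by
    by_cases hne : Nonempty g.Site
    · exact Or.inl (hrow.nonneg (Classical.arbitrary _))
    · exact Or.inr (not_nonempty_iff.mp hne)
  rcases hc with hc | hemp
  · have houter : HasMaj bB bout (H ∘ₗ (Dfr ∘ₗ (A0 + H0)))
        (fun y y' => bB.κ * AH * (bN.κ * θD * (C + A₀) * c) * c * Real.exp (-(δ₀ / 8 * g.dist y y'))) :=
      hasMaj_comp_exp (ρ := δ₀ / 8) htri hd hrow hAH
        (mul_nonneg (mul_nonneg (mul_nonneg bN.κ_nonneg hθD) (add_nonneg hC hA₀)) hc) (by linarith) le_rfl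
        (by linarith) hH hinner
    unfold Ineq190
    rw [h182]
    exact (hsum'.sub houter).mono fun y y' => le_of_eq (by ring)
  · intro y' μ _ y
    exact (IsEmpty.false y).elim

/-- **(189) ⇒ (190), entries n = 0, 1** (p. 308: *"This inequality, the formula (188) and Lemma 2.1 … yield (190)"*),
KERNEL-CHECKED with every constant explicit and every analytic input a hypothesis of the printed shape (see
`A0_majorant_of_189`, `dH_majorant_of_182`): δ𝓗 = (δ/δB)𝓗 has majorant const190·e^{−⅛δ₀d(y,y′)} from the B-size to the
size max{|·|_{(−1)}, |∇·|_{(−2)}} — the RATE ⅛δ₀ of (190) DERIVED from the ¼δ₀ of (189) as the α = ½ loss of Lemma 2.1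
[3], under the LOCATED smallness q < 1 of (187).  NOT discharged: (189) (`h189`, G-B11-G2); *"finally Proposition 2
and (181)"*. [cite: Balaban1985Variational, (182)–(190) pp.307–308; Balaban1984PropagatorsII, Lemma 2.1 p.234] -/
theorem ineq190_of_189 {bB : BlockNorm g FB} {bN : BlockNorm g FA} {b3 : BlockNorm g F3}
    {Gt : F3 →ₗ[ℝ] FA} {W : FA →ₗ[ℝ] F3} {D2H0 : FB →ₗ[ℝ] F3} {H0 H A0 dH : FB →ₗ[ℝ] FA} {Dfr : FA →ₗ[ℝ] FB}
    {δ₀ BG θW cΔ A₀ AH θD M₀ c : ℝ}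
    (htri : Triangle254 g) (hd : ∀ a b : g.Site, 0 ≤ g.dist a b) (hδ₀ : 0 ≤ δ₀) (hrow : RowSum g (δ₀ / 8) c)
    (hc : 0 ≤ c) (hBG : 0 ≤ BG) (hθW : 0 ≤ θW) (hcΔ : 0 ≤ cΔ) (hA₀ : 0 ≤ A₀) (hAH : 0 ≤ AH) (hθD : 0 ≤ θD)
    (hM₀ : 0 ≤ M₀)
    (hG : HasMaj b3 bN Gt (fun y y' => BG * Real.exp (-(δ₀ * g.dist y y'))))
    (h189 : Ineq189 bN b3 W θW δ₀)
    (hD2H0 : HasMaj bB b3 D2H0 (fun y y' => cΔ * Real.exp (-(δ₀ * g.dist y y'))))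
    (hH0 : HasMaj bB bN H0 (fun y y' => A₀ * Real.exp (-(δ₀ * g.dist y y'))))
    (hH : HasMaj bB bN H (fun y y' => AH * Real.exp (-(δ₀ / 2 * g.dist y y'))))
    (hDfr : HasMaj bN bB Dfr (fun y y' => θD * Real.exp (-(δ₀ / 2 * g.dist y y'))))
    (h184 : Eq184 A0 H0 Gt W D2H0) (h188 : Bound188 bB bN A0 M₀) (h182 : Eq182 dH A0 H0 H Dfr)
    (hq : qG b3.κ bN.κ BG θW c < 1) :
    Ineq190 bB bN dH (const190 bB.κ bN.κ b3.κ BG θW cΔ A₀ AH θD c) δ₀ := by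
  have hA0 := A0_majorant_of_189 htri hd hδ₀ hrow hc hBG hθW hcΔ hA₀ hM₀ hG h189 hD2H0 hH0 h184 h188 hq
  have hCA : 0 ≤ constA0 b3.κ bN.κ BG θW cΔ A₀ c :=
    constA0_nonneg b3.κ_nonneg bN.κ_nonneg hBG hθW hcΔ hA₀ hc hq
  have h := dH_majorant_of_182 (bout := bN) htri hd hδ₀ hrow hCA hA₀ hA₀ hAH hθD hA0 hH0 hA0 hH0 hH hDfr h182
  unfold Ineq190 at h ⊢
  refine h.mono fun y y' => le_of_eq ?_
  unfold const190
  ring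

/-- **Entries n = 3, 4 (and n = 2) of (190) need no second Neumann series** — census item (iii): once 𝔄₀ decays in the
N-size (`A0_majorant_of_189`), ONE more use of (184), 𝔄₀ = G̃[Δ^{(2)}H₀ − W H₀ − W 𝔄₀], with a majorant of G̃ INTO the
stronger local size `bN₂` (the second-order / Hölder part of *"exactly the same properties as Δ_a⁻¹"*, p. 306 — [5]
(3.42)–(3.47); cell GAPS G-B11-G1) gives 𝔄₀ the majorant κ₃B′_G[c_Δ + κ_Nθ_W(A₀ + C)c]c·e^{−⅛δ₀d} into `bN₂`.
[cite: Balaban1985Variational, (184)–(190) pp.307–308] -/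
theorem A0_strong_of_184 {bB : BlockNorm g FB} {bN bN₂ : BlockNorm g FA} {b3 : BlockNorm g F3}
    {Gt : F3 →ₗ[ℝ] FA} {W : FA →ₗ[ℝ] F3} {D2H0 : FB →ₗ[ℝ] F3} {H0 A0 : FB →ₗ[ℝ] FA}
    {δ₀ BG₂ θW cΔ A₀ C c : ℝ}
    (htri : Triangle254 g) (hd : ∀ a b : g.Site, 0 ≤ g.dist a b) (hδ₀ : 0 ≤ δ₀) (hrow : RowSum g (δ₀ / 8) c)
    (hc : 0 ≤ c) (hBG₂ : 0 ≤ BG₂) (hθW : 0 ≤ θW) (hcΔ : 0 ≤ cΔ) (hA₀ : 0 ≤ A₀) (hC : 0 ≤ C)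
    (hG₂ : HasMaj b3 bN₂ Gt (fun y y' => BG₂ * Real.exp (-(δ₀ * g.dist y y'))))
    (h189 : Ineq189 bN b3 W θW δ₀)
    (hD2H0 : HasMaj bB b3 D2H0 (fun y y' => cΔ * Real.exp (-(δ₀ * g.dist y y'))))
    (hH0 : HasMaj bB bN H0 (fun y y' => A₀ * Real.exp (-(δ₀ * g.dist y y'))))
    (hA0 : HasMaj bB bN A0 (fun y y' => C * Real.exp (-(δ₀ / 8 * g.dist y y'))))
    (h184 : Eq184 A0 H0 Gt W D2H0) :
    HasMaj bB bN₂ A0 (fun y y' =>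
      b3.κ * BG₂ * (cΔ + bN.κ * θW * (A₀ + C) * c) * c * Real.exp (-(δ₀ / 8 * g.dist y y'))) := by
  -- (184) rearranged: 𝔄₀ = G̃ (Δ^{(2)}H₀ − W H₀ − W 𝔄₀)
  have hrepr : ∀ μ, A0 μ = (Gt ∘ₗ (D2H0 - W ∘ₗ H0 - W ∘ₗ A0)) μ := by
    intro μ
    have hpt := LinearMap.congr_fun h184 μ
    simp only [LinearMap.add_apply, LinearMap.comp_apply, LinearMap.sub_apply] at hpt ⊢
    rw [map_sub, map_sub]
    have : A0 μ = Gt (D2H0 μ) - Gt (W (H0 μ)) - Gt (W (A0 μ)) := by rw [← hpt]; abel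
    exact this
  have hWH0 : HasMaj bB b3 (W ∘ₗ H0) (fun y y' => bN.κ * θW * A₀ * c * Real.exp (-(δ₀ / 8 * g.dist y y'))) :=
    hasMaj_comp_exp (ρ := δ₀ / 8) htri hd hrow hθW hA₀ (by linarith) (by linarith) (by linarith) h189 hH0
  have hWA0 : HasMaj bB b3 (W ∘ₗ A0) (fun y y' => bN.κ * θW * C * c * Real.exp (-(δ₀ / 8 * g.dist y y'))) :=
    hasMaj_comp_exp (ρ := δ₀ / 8) htri hd hrow hθW hC (by linarith) le_rfl (by linarith) h189 hA0
  have hT : HasMaj bB b3 (D2H0 - W ∘ₗ H0 - W ∘ₗ A0)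
      (fun y y' => (cΔ + bN.κ * θW * (A₀ + C) * c) * Real.exp (-(δ₀ / 8 * g.dist y y'))) :=
    (((hD2H0.of_rate_le (ρ := δ₀ / 8) hd hcΔ (by linarith)).sub hWH0).sub hWA0).mono fun y y' => le_of_eq (by ring)
  have hcoef : 0 ≤ cΔ + bN.κ * θW * (A₀ + C) * c := by
    have := bN.κ_nonneg; positivity
  have hGT := hasMaj_comp_exp (ρ := δ₀ / 8) htri hd hrow hBG₂ hcoef (by linarith) le_rfl (by linarith) hG₂ hT
  exact (hGT.congr fun μ => (hrepr μ).symm).mono fun y y' => le_of_eq (by ring)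

/-- **(189) ⇒ (190), entries n = 3, 4 (resp. n = 2)**: with majorants INTO the second-order (resp. Hölder) local size
`bN₂` for G̃ (G-B11-G1), H₀ ((130) p. 297, printed: *"|Δ_{U₀}H₀B|_{(−3)} ≤ B₀|B|"* with the kernel decay e^{−δ₀d}) and H
((137)–(139) p. 298, *"D*DH, Δ_{U₀}H are bounded in the norm |·|_{(−3)}"*; cell GAPS G-B11-E4R), the derivative δ𝓗 has
a majorant C·e^{−⅛δ₀d} into `bN₂` — the same chain, no further input.  These three majorants are the LOCATED inputs of
the last three entries of (190). [cite: Balaban1985Variational, (130) p.297 + (137)–(139) p.298 + (190) p.308] -/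
theorem ineq190_strong_of_189 {bB : BlockNorm g FB} {bN bN₂ : BlockNorm g FA} {b3 : BlockNorm g F3}
    {Gt : F3 →ₗ[ℝ] FA} {W : FA →ₗ[ℝ] F3} {D2H0 : FB →ₗ[ℝ] F3} {H0 H A0 dH : FB →ₗ[ℝ] FA} {Dfr : FA →ₗ[ℝ] FB}
    {δ₀ BG BG₂ θW cΔ A₀ A₀₂ AH₂ θD M₀ c : ℝ}
    (htri : Triangle254 g) (hd : ∀ a b : g.Site, 0 ≤ g.dist a b) (hδ₀ : 0 ≤ δ₀) (hrow : RowSum g (δ₀ / 8) c)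
    (hc : 0 ≤ c) (hBG : 0 ≤ BG) (hBG₂ : 0 ≤ BG₂) (hθW : 0 ≤ θW) (hcΔ : 0 ≤ cΔ) (hA₀ : 0 ≤ A₀) (hA₀₂ : 0 ≤ A₀₂)
    (hAH₂ : 0 ≤ AH₂) (hθD : 0 ≤ θD) (hM₀ : 0 ≤ M₀)
    (hG : HasMaj b3 bN Gt (fun y y' => BG * Real.exp (-(δ₀ * g.dist y y'))))
    (hG₂ : HasMaj b3 bN₂ Gt (fun y y' => BG₂ * Real.exp (-(δ₀ * g.dist y y'))))
    (h189 : Ineq189 bN b3 W θW δ₀)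
    (hD2H0 : HasMaj bB b3 D2H0 (fun y y' => cΔ * Real.exp (-(δ₀ * g.dist y y'))))
    (hH0 : HasMaj bB bN H0 (fun y y' => A₀ * Real.exp (-(δ₀ * g.dist y y'))))
    (hH0₂ : HasMaj bB bN₂ H0 (fun y y' => A₀₂ * Real.exp (-(δ₀ * g.dist y y'))))
    (hH₂ : HasMaj bB bN₂ H (fun y y' => AH₂ * Real.exp (-(δ₀ / 2 * g.dist y y'))))
    (hDfr : HasMaj bN bB Dfr (fun y y' => θD * Real.exp (-(δ₀ / 2 * g.dist y y'))))
    (h184 : Eq184 A0 H0 Gt W D2H0) (h188 : Bound188 bB bN A0 M₀) (h182 : Eq182 dH A0 H0 H Dfr)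
    (hq : qG b3.κ bN.κ BG θW c < 1) :
    ∃ C : ℝ, 0 ≤ C ∧ Ineq190 bB bN₂ dH C δ₀ := by
  have hA0 := A0_majorant_of_189 htri hd hδ₀ hrow hc hBG hθW hcΔ hA₀ hM₀ hG h189 hD2H0 hH0 h184 h188 hq
  have hCA : 0 ≤ constA0 b3.κ bN.κ BG θW cΔ A₀ c :=
    constA0_nonneg b3.κ_nonneg bN.κ_nonneg hBG hθW hcΔ hA₀ hc hq
  have hA0₂ := A0_strong_of_184 htri hd hδ₀ hrow hc hBG₂ hθW hcΔ hA₀ hCA hG₂ h189 hD2H0 hH0 hA0 h184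
  refine ⟨_, ?_, dH_majorant_of_182 (bout := bN₂) htri hd hδ₀ hrow hCA hA₀ hA₀₂ hAH₂ hθD hA0 hH0 hA0₂ hH0₂
    hH₂ hDfr h182⟩
  have := bB.κ_nonneg; have := bN.κ_nonneg; have := b3.κ_nonneg
  positivity

end SectG

end Literature.MathematicalPhysics.QuantumFieldTheory.Balaban1983to89.B11SectG
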